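import Summits.RiemannHypothesis.RiemannHypothesis.Theorems.MotivicDoorCertPosGram
import HarnessLib

/-!
# Motivic door / CERTPOS — packed encoding of a Gram certificate (one numeral per matrix row)

pub-rhdoor (MOTIVIC-DOOR ticket), unit `certpos`. HONEST FRAMING: lottery ticket at the motivic door; RH probability negligible;
this file is bookkeeping for finite certificates, it makes no claim about ζ.

`MotivicDoorCertPosGram` stores the integer data of a `rhdoor.certpos/1` certificate as `List (List ℤ)`. For blocks of dimension
k ≈ 100 that is ≈ 15 000 numeric literals, which the elaborator handles slowly; here every matrix ROW is stored as ONE natural number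
in base `2^B` with an offset (two's-complement-free): row `i` of `C` is `Σ_j (C i j + 2^(B−1)) · 2^(B·j)` with `|C i j| < 2^(B−1)`,
row `i` of the Cholesky factor `L` packs its `i+1` entries the same way with width `BL`, and row `i` of the (nonnegative) radius
matrix `r` packs `r i j · 2^(Br·j)`. `PackedCert.toGramCert` decodes back to a `GramCert`; all soundness statements
(`GramCert.margin_le_bottomRayleigh`, `GramCert.bottomRayleigh_le_of_upperOK`) are applied to the decoded certificate, and the kernel
evaluates the decoding on the fly inside `decide` (only `Nat.shiftRight`, `Nat.mod`, `Nat.pow`, which the kernel computes with GMP).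

## References
- [folklore] positional (base-2^B) encoding of integer vectors; the certificate scheme itself is documented in `MotivicDoorCertPosGram`.
-/

namespace Summit.RiemannHypothesis.RiemannHypothesis.Theorems.MotivicDoor.CertPos

/-- A `rhdoor.certpos/1` certificate with every matrix row packed into one natural number (see the module docstring). [folklore] -/
structure PackedCert where
  /-- dimension -/
  k : ℕ
  /-- entry scale exponent: entries are `C i j / 2^t ± r i j / 2^t` -/
  t : ℕ
  /-- factor scale exponent: `L i l / 2^u` -/
  u : ℕ
  /-- bits per packed `C` entry (entries offset by `2^(B-1)`) -/
  B : ℕ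
  /-- bits per packed `L` entry (entries offset by `2^(BL-1)`) -/
  BL : ℕ
  /-- bits per packed `r` entry (no offset) -/
  Br : ℕ
  /-- packed rows of `C` (length `k`, row `i` holds `k` digits) -/
  C : List ℕ
  /-- packed rows of `r` -/
  r : List ℕ
  /-- the shift numerator `m` (scale `2^t`) -/
  m : ℤ
  /-- packed rows of `L` (row `i` holds `i+1` digits) -/
  L : List ℕ
  /-- the claimed row budget `b` (scale `2^(2u)`) -/
  b : ℕ

namespace PackedCert

/-- digit `j` of `row` in base `2^B`. [folklore] -/
def digit (B row j : ℕ) : ℕ := (row >>> (B * j)) % 2 ^ B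

/-- signed digit: `digit − 2^(B−1)`. [folklore] -/
def sdigit (B row j : ℕ) : ℤ := (digit B row j : ℤ) - ((2 ^ (B - 1) : ℕ) : ℤ)

/-- the first `n` signed digits of `row`. [folklore] -/
def unpackRow (B n row : ℕ) : List ℤ := (List.range n).map (sdigit B row)

variable (p : PackedCert)

/-- DECODING to the list-based certificate of `MotivicDoorCertPosGram`. [folklore] -/
def toGramCert : GramCert where
  k := p.k
  t := p.t
  u := p.u
  C := (List.range p.k).map fun i => unpackRow p.B p.k (p.C.getD i 0)
  r := (List.range p.k).map fun i => (List.range p.k).map fun j => digit p.Br (p.r.getD i 0) j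
  m := p.m
  L := (List.range p.k).map fun i => unpackRow p.BL (i + 1) (p.L.getD i 0)
  b := p.b

end PackedCert

end Summit.RiemannHypothesis.RiemannHypothesis.Theorems.MotivicDoor.CertPos
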